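import Summits.Ventures.PercRepro.Night2BasisCapFloor
import Summits.Ventures.PercRepro.Night2ThreeTwoBasisAssembly
import Summits.Ventures.PercRepro.Night2FatXFaces

/-!
# night-2: the NON-FAT case of (FAIR) — the level structure of the `vCap` face criterion (gen 37)

The cell `(2, 1)` of h21 (`G ∈ flatsQ 6`, `|gr ∖ G| = 2`, one coloop `K = {e₀}`, simple, loopless) with NO fat closure
(`fatClosures M 5 G 2 = ∅`: every thin member misses `≥ 3` points of `G`) is the last open sub-case of h21 after
`localShadowHall_fat` (gen 36).  Its interface of record is `basis_pair_fair_of_vCap_face_sum_subfamily` (gen 32): the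
fair share of a lossy basis pair `(B, z)`, `Q = B ∪ {z}`, follows from `1 ≤ Σ_{T ∈ 𝒯} vCap T / faceSum T` on ANY
sub-family `𝒯` of its targets `Q ∪ Y`.  This module records the facts about single targets that every such sum uses:

* `three_le_card_sdiff_of_nonfat`: with no fat closure every thin member misses `≥ 3` points, so `phiFace ≤ 1/9`
  (`phiFace_le_of_nonfat`);
* `L1_eq_zero_of_rkN_sdiff_le_three`: no thin covering preimage when `rk (G ∖ T) ≤ 3` (a preimage `B` leaves
  `gr ∖ B ⊆ (G ∖ T) ∪ {z} ∪ (gr ∖ G)` of rank `≤ 6`); with `capS_eq_one_of_rkN_sdiff_le_three` this gives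
  **`vCap_eq_one_of_rkN_sdiff_le_three`**: an unloaded target whose complement has rank `≤ 3` carries the full
  capacity `1` — on the nested-line geometries (`W` of rank `4` with coloops) this is the typical target;
* `sdiff_insert_eq_of_mem_tgtSets`: at a target `T = Q ∪ Y` the complement `G ∖ T` is `W ∖ Y` (`W = G ∖ Q`);
* `faceSum_pos_of_mem_tgtSets`: the face sum of a target of a lossy basis pair is positive (it dominates `D` times the
  loss mass, which contains the pair's own weight `rhoL > 0`), so the terms `vCap T / faceSum T` are honest quotients;
* `level_one_targets_subset`, `sum_level_one`: the level-1 targets `Q ∪ {y}`, `y ∈ W`, form a sub-family indexed by `W`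
  (the map `y ↦ insert y Q` is injective), so `Σ_{y ∈ W} f (insert y Q)` is a sum over a sub-family of the targets;
* **`basis_pair_fair_of_level_one_sum`**: the fair share of a lossy basis pair from its level-1 targets alone:
  `1 ≤ Σ_{y ∈ G ∖ Q} vCap (insert y Q) / faceSum (insert y Q)`.
Paper: proofs/NIGHT-2-g37.md §1.
-/

namespace PercRepro.Shadow

open PercRepro.ThmH PercRepro.PerFlat

variable {α : Type*} [DecidableEq α] {M : Matroid α} [M.Finite] {G : Finset α}

/-! ## No fat closure: every thin member misses three points -/

/-- **With no fat closure every thin member misses at least three points of `G`.** -/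
theorem three_le_card_sdiff_of_nonfat (hnf : fatClosures M 5 G 2 = ∅) {B : Finset α}
    (hB : B ∈ thinMembers M 5 G) : 3 ≤ (G \ clF M B).card := by
  by_contra h
  rw [not_le] at h
  have h1 : clF M B ∈ fatClosures M 5 G 2 := by
    unfold fatClosures
    rw [Finset.mem_image]
    exact ⟨B, Finset.mem_filter.2 ⟨hB, by omega⟩, rfl⟩
  rw [hnf] at h1
  exact Finset.notMem_empty _ h1

/-- With no fat closure `phiFace ≤ 1/9` at every thin member. -/
theorem phiFace_le_of_nonfat (hG : G ∈ flatsQ M (5 + 1)) (hd : (gr M \ G).card = 2)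
    (hnf : fatClosures M 5 G 2 = ∅) {B : Finset α} (hB : B ∈ thinMembers M 5 G) : phiFace M B ≤ 1 / 9 :=
  phiFace_le_of_three_le hG hd hB (three_le_card_sdiff_of_nonfat hnf hB)

/-! ## Targets whose complement has rank at most three -/

/-- **No thin covering preimage when the complement has rank `≤ 3`**: a covering preimage `B` of `T` has
`gr ∖ B ⊆ (G ∖ T) ∪ {z} ∪ (gr ∖ G)`, of rank `≤ 3 + 1 + 2 < 7`. -/
theorem L1_eq_zero_of_rkN_sdiff_le_three (hd : (gr M \ G).card = 2) {T : Finset α}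
    (hr : rkN M (G \ T) ≤ 3) : L1 M 5 G T = 0 := by
  unfold L1
  apply Finset.sum_eq_zero
  intro B hB
  exfalso
  rw [Finset.mem_filter, mem_coverPreimages] at hB
  obtain ⟨⟨hBm, hcov⟩, -⟩ := hB
  obtain ⟨z, hz, rfl⟩ := mem_coverSets.1 hcov
  have hBU : B ∈ Uq M (5 + 2) 5 := (mem_membersIn.1 hBm).1
  have h7 := rkN_sdiff_eq_of_mem_Uq hBU
  have hsub : gr M \ B ⊆ ((G \ insert z B) ∪ {z}) ∪ (gr M \ G) := by
    intro e he
    rw [Finset.mem_sdiff] at he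
    rw [Finset.mem_union, Finset.mem_union, Finset.mem_sdiff, Finset.mem_singleton, Finset.mem_sdiff,
      Finset.mem_insert]
    by_cases heG : e ∈ G
    · by_cases hez : e = z
      · exact Or.inl (Or.inr hez)
      · exact Or.inl (Or.inl ⟨heG, fun h => h.elim hez he.2⟩)
    · exact Or.inr ⟨he.1, heG⟩
  have h1 := rkN_mono (M := M) hsub
  have h2 := rkN_union_le_add_card (M := M) ((G \ insert z B) ∪ {z}) (gr M \ G)
  have h3 := rkN_union_le_add_card (M := M) (G \ insert z B) {z}
  rw [hd] at h2
  rw [Finset.card_singleton] at h3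
  omega

/-- **An unloaded target whose complement has rank `≤ 3` carries the full capacity**: `vCap T = 1`. -/
theorem vCap_eq_one_of_rkN_sdiff_le_three (hd : (gr M \ G).card = 2) {T : Finset α}
    (hdl : dload M 5 G (bigP M G) (dshGT2 M 5 G) T = 0) (hr : rkN M (G \ T) ≤ 3) : vCap M G T = 1 := by
  unfold vCap
  by_cases h1 : (G \ T).card ≤ 1
  · rw [if_pos h1]
  · rw [if_neg h1, if_pos hdl, capS_eq_one_of_rkN_sdiff_le_three hd hr, L1_eq_zero_of_rkN_sdiff_le_three hd hr]
    norm_num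

/-! ## The complement of a target -/

/-- At a target `T ⊇ Q` the complement `G ∖ T` is `(G ∖ Q) ∖ (T ∖ Q)`. -/
theorem sdiff_eq_sdiff_sdiff_of_subset {Q T : Finset α} (hQT : Q ⊆ T) : G \ T = (G \ Q) \ (T \ Q) := by
  ext e
  simp only [Finset.mem_sdiff]
  constructor
  · rintro ⟨heG, heT⟩
    exact ⟨⟨heG, fun h => heT (hQT h)⟩, fun h => heT h.1⟩
  · rintro ⟨⟨heG, heQ⟩, h⟩
    exact ⟨heG, fun heT => h ⟨heT, heQ⟩⟩

/-- At the level-1 target `insert y Q` the complement in `G` is `(G ∖ Q).erase y`. -/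
theorem sdiff_insert_eq_erase {Q : Finset α} {y : α} :
    G \ insert y Q = (G \ Q).erase y := by
  ext e
  simp only [Finset.mem_sdiff, Finset.mem_insert, Finset.mem_erase, not_or]
  constructor
  · rintro ⟨heG, hey, heQ⟩
    exact ⟨hey, heG, heQ⟩
  · rintro ⟨hey, heG, heQ⟩
    exact ⟨heG, hey, heQ⟩

/-! ## Positivity of the face sums at the targets of a lossy pair -/

/-- **The face sum of a target of a lossy basis pair is positive**: `D · pi2MassH T ≤ faceSum T` and
`pi2MassH T ≥ rhoL B z > 0`. -/
theorem faceSum_pos_of_mem_tgtSets (hG : G ∈ flatsQ M (5 + 1)) (hd : (gr M \ G).card = 2)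
    (hk : kColoops M G = 1) {B : Finset α} (hB : B ∈ thinMembers M 5 G) (hnP : ¬ bigP M G B) {z : α}
    (hz : z ∈ G \ clF M B) (hl0 : loss M 5 G B z ≠ 0) {T : Finset α} (hT : T ∈ tgtSets M 5 G B z) :
    0 < faceSum M G T := by
  have hd' : (gr M \ G).card ≤ 5 := by omega
  have hρ := rhoL_pos_of_loss_ne hG hd' hB hz hl0
  have hmass := rhoL_le_pi2MassH (P := bigP M G) hG hd' hB hnP hz hT
  have hface := pi2MassH_le_face_sum hG hd hk (subset_G_of_mem_shadowAt (mem_tgtSets.1 hT).1)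
    (coloops_subset_of_mem_shadowAt (mem_tgtSets.1 hT).1)
  have hDpos : (0 : ℚ) < ((2 ^ (G.card - 6) - 1 : ℕ) : ℚ) := by
    have h7 : 7 ≤ G.card := by
      have hKB : coloops M G ⊆ B := coloops_subset_of_mem_thinMembers hG hd' hB
      have hBG : B ⊆ G := subset_G_of_mem_thinMembers hB
      have h1 := Finset.card_sdiff_add_card_eq_card hKB
      rw [← kColoops_eq_card_coloops, hk] at h1
      have h2 := two_le_card_sdiff_of_not_lay0 hG hd' (mem_thinMembers.1 hB).1 (mem_thinMembers.1 hB).2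
      have hdisj : Disjoint B (G \ clF M B) := by
        rw [Finset.disjoint_left]
        intro a ha ha'
        exact (Finset.mem_sdiff.1 ha').2 (subset_clF_of_subset_gr (hBG.trans (mem_flatsQ.1 hG).1) ha)
      have h3 := Finset.card_le_card (Finset.union_subset hBG (Finset.sdiff_subset : G \ clF M B ⊆ G))
      rw [Finset.card_union_of_disjoint hdisj] at h3
      have h4 := card_sdiff_eq_four_of_not_bigP hG hd hk hB hnP
      omega
    have : 2 ≤ 2 ^ (G.card - 6) := by
      calc 2 = 2 ^ 1 := by norm_num
        _ ≤ 2 ^ (G.card - 6) := Nat.pow_le_pow_right (by norm_num) (by omega)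
    exact_mod_cast (by omega : 0 < 2 ^ (G.card - 6) - 1)
  unfold faceSum
  have hpos : 0 < pi2MassH M 5 G (bigP M G) T := lt_of_lt_of_le hρ hmass
  have := lt_of_lt_of_le hpos hface
  rw [lt_div_iff₀ hDpos] at this
  linarith

/-! ## The level-1 sub-family -/

/-- The level-1 targets of the pair `(B, z)`: the sets `insert y Q` for `y ∈ G ∖ Q`, `Q = insert z B`. -/
theorem level_one_targets_subset (hG : G ∈ flatsQ M (5 + 1)) {B : Finset α} (hB : B ∈ thinMembers M 5 G)
    {z : α} (hz : z ∈ G \ clF M B) :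
    (G \ insert z B).image (fun y => insert y (insert z B)) ⊆ tgtSets M 5 G B z := by
  intro T hT
  rw [Finset.mem_image] at hT
  obtain ⟨y, hy, rfl⟩ := hT
  rw [tgtSets_eq_image hG (mem_thinMembers.1 hB).1 hz, Finset.mem_image]
  refine ⟨{y}, Finset.mem_filter.2 ⟨Finset.mem_powerset.2 (Finset.singleton_subset_iff.2 hy),
    Finset.singleton_nonempty y⟩, ?_⟩
  rw [Finset.union_comm, ← Finset.insert_eq]

/-- A sum over the level-1 targets is a sum over `W = G ∖ Q`. -/
theorem sum_level_one {Q : Finset α} (f : Finset α → ℚ) :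
    ∑ T ∈ (G \ Q).image (fun y => insert y Q), f T = ∑ y ∈ G \ Q, f (insert y Q) := by
  rw [Finset.sum_image]
  intro y hy y' hy' h
  have hyQ : y ∉ Q := (Finset.mem_sdiff.1 hy).2
  simp only at h
  have h1 : y ∈ insert y' Q := by
    rw [← h]
    exact Finset.mem_insert_self _ _
  rw [Finset.mem_insert] at h1
  exact h1.resolve_right hyQ

/-- **The fair share from the level-1 targets alone**: `1 ≤ Σ_{y ∈ G ∖ Q} vCap (insert y Q) / faceSum (insert y Q)`
gives the fair share of the lossy basis pair `(B, z)`, `Q = insert z B`. -/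
theorem basis_pair_fair_of_level_one_sum (hG : G ∈ flatsQ M (5 + 1)) (hd : (gr M \ G).card = 2)
    (hk : kColoops M G = 1) (hs : ∀ e ∈ gr M, ∀ f ∈ gr M, e ≠ f → rkN M {e, f} = 2)
    (hl : ∀ e ∈ gr M, M.Indep {e}) (hfat : (fatClosures M 5 G 2).card ≤ 1)
    {B : Finset α} (hB : B ∈ thinMembers M 5 G) (hnP : ¬ bigP M G B) {z : α} (hz : z ∈ G \ clF M B)
    (hl0 : loss M 5 G B z ≠ 0)
    (hsum : 1 ≤ ∑ y ∈ G \ insert z B, vCap M G (insert y (insert z B)) / faceSum M G (insert y (insert z B))) :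
    loss M 5 G B z ≤ rhoL M 5 G B z * lossIncomeH M 5 G (bigP M G) (dshGT2 M 5 G) B z := by
  apply basis_pair_fair_of_vCap_face_sum_subfamily hG hd hk hs hl hfat hB hnP hz hl0
    (level_one_targets_subset hG hB hz)
  rw [sum_level_one]
  exact hsum

end PercRepro.Shadow
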